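import Literature.Probability.RandomPlanarGeometry.HexSAWStripAmplitudeRatio
import Literature.Probability.Process.MatrixRenewalReward
import HarnessLib

/-!
# The density of renewal points of long critical strip bridges: a critical bridge with exactly `n` steps has `ν_T · n + o(n)` renewal
# vertices, `ν_T = ⟨ℓ, u⟩/⟨ℓ, M̄_len u⟩`, along every parity class and for every pair of levels (module «RENEWAL-POINT-DENSITY»)

Topic `Literature/Probability/RandomPlanarGeometry` (continues «AMPLITUDE-RATIO» `HexSAWStripAmplitudeRatio.lean` — explicit length residue
`tendsto_stripLenD_residue_explicit`, fixed vectors; uses the tree's renewal combinatorics of `HexSAWStripBridgeRenewal.lean` (`npieces`, `fstP/sndP`,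
`npieces_sndP`, `renIdxs_fstP`, `split_injOn`, `hcat`, `wD_eq_mul_fstP_sndP`), the length slices and the first-piece split of
`HexSAWStripBridgeLengthPointwise(Law).lean` / `HexSAWStripBridgeLengthRenewal.lean` (`LUset/LMset`, `hcat_mem_LUset`, `LUM_le_split`/`split_le_LUM` — whose
proofs §1 follows line by line with the weight `npieces · wD` — `hatM/hatD`, `hat_trunc`, `hatPair_critical`), and the elementary renewal theorem for
pieces of `Process/MatrixRenewalReward.lean` (`RewardPair.tendsto_S_div_D` with `R = Î`, a-p2 g23)).  Lane «pcv-sawmu» (CriticalPhenomena venture),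
a-p2 g23.  Sources of the SETTING: W. Feller I (1968) XIII.3 (elementary renewal theorem; periodic sequences), XIII.11; H. Duminil-Copin, A. Hammond,
CMP 324 (2013) §2.2 (renewal points of bridges).  Nothing of the kind is printed for the strip.

## What is proved (namespace `Literature.Probability.RandomPlanarGeometry.SAW.HV`; `P_σ(a,b) := Σ_{l ∈ LUset T N σ a b} npieces(l)·wD T y l` — bridges
## `a → b` with `σ` steps counted with multiplicity = their number of irreducible pieces = number of renewal vertices + 1; hat index `n_k = 2k + χ_a − χ_b`)

* §1 ★★ `split_le_pieces`, ★★ `pieces_le_split`, ★★★ `pieces_eq_split` — `P_σ = M_σ + Σ_{τ∈[1,σ)} M_τ·(U_{σ−τ} + P_{σ−τ})` (`σ ≤ N`, `y ≥ 0`): the first-piece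
  split with the piece count (`npieces_sndP`: the remainder has one piece fewer); `npieces_map_shift`.
* §2 `pieces_eq_zero_of_le`, `pieces_eq_zero_of_not_even`, `pieces_trunc_eq`; ★★ `hat_pieces_ren` — `P̂(k) = M̂(k) + Σ_{i+j=k} M̂(i)(D̂(j) + P̂(j))`.
* §3 `hat_pieces_facts` (`0 ≤ P̂(k) ≤ (2k+3)D̂(k)`); ★★★★ `tendsto_hat_pieces_div` (`T ≥ 2`; `u`, `ℓ` positive fixed vectors of `Iinf T y_T`) —
  `P̂(k)_{ab}/((k+1)D̂(k)_{ab}) → 2⟨ℓ,u⟩/⟨ℓ,M̄_len u⟩`; ★★★★ `tendsto_pieces_per_step` — **`P̂(k)_{ab}/(n_k·D̂(k)_{ab}) → ν_T := ⟨ℓ,u⟩/⟨ℓ,M̄_len u⟩`**: the mean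
  number of renewal vertices PER STEP of a critical strip bridge with exactly `n` steps converges to `ν_T` = 1/(mean length of an irreducible piece in
  the invariant weighting), for every pair of levels `a, b`.

Label: LANE THEOREM (own result of lane «pcv-sawmu», a-p2 g23, 2026-08-27); classical template = the elementary renewal theorem (Feller XIII.3).
NOT claimed: concentration / LLN for one bridge, β-walks, `T = 1`, a closed form of `ν_T` for any `T` (none is known to us, even for `T = 2`), rates.
-/

noncomputable section

namespace Literature.Probability.RandomPlanarGeometry.SAW

open Finset Filter Topology Matrix BigOperators
open Literature.Analysis.Matrix Literature.Probability.Process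

namespace HV

variable {T N : ℕ} {y : ℝ} {σ : ℤ}

/-! ### §1 The piece-count split: `P_σ = M_σ + Σ_τ M_τ (U_{σ−τ} + P_{σ−τ})` -/

section Split

/-- `npieces` is invariant under the horizontal shift of the remainder (plumbing). [cite: DuminilCopinHammond2013, §2.2; lane plumbing a-p2 g23] -/
theorem npieces_map_shift (x : ℤ) (l : List HV) : npieces (l.map (shift x 0)) = npieces l := by
  rw [npieces, npieces, renIdxs_map_shift]

/-- ★★ **Gluing direction of the piece-count split** (`σ ≤ N`, `y ≥ 0`): with `P_σ(a,b) := Σ_{bridges a→b, σ steps} npieces · wD`,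
`M_σ(a,b) + Σ_{τ∈[1,σ)} Σ_c M_τ(a,c)·(U_{σ−τ}(c,b) + P_{σ−τ}(c,b)) ≤ P_σ(a,b)` — gluing an irreducible first piece to a bridge with `k` pieces gives a
bridge with `k + 1` pieces (`npieces_sndP`), injectively (as in the tree's `split_le_LUM`). [cite: DuminilCopinHammond2013, §2.2 (unique decomposition at renewal points); lane «pcv-sawmu» a-p2 g23 — own] -/
theorem split_le_pieces (hy : 0 ≤ y) (hσN : σ ≤ N) (a b : Fin (2 * T)) :
    LMM T N σ y a b + (∑ τ ∈ Finset.Ico (1 : ℤ) σ, LMM T N τ y *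
        (LUM T N (σ - τ) y + Matrix.of fun c d : Fin (2 * T) =>
          ∑ l ∈ LUset T N (σ - τ) (c : ℕ) (d : ℕ), (npieces l : ℝ) * wD T y l)) a b ≤
      ∑ l ∈ LUset T N σ (a : ℕ) (b : ℕ), (npieces l : ℝ) * wD T y l := by
  classical
  set S := LUset T N σ (a : ℕ) (b : ℕ) with hS
  set Sirr := S.filter fun l => renIdxs l = ∅ with hSirr
  set Sred := S.filter fun l => renIdxs l ≠ ∅ with hSred
  have hψ0 : ∀ l : List HV, 0 ≤ (npieces l : ℝ) * wD T y l := fun l => mul_nonneg (Nat.cast_nonneg _) (wD_nonneg T hy _)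
  -- (1) irreducible part: `LMset ⊆ Sirr`, and there `npieces = 1`
  have hirr : LMM T N σ y a b ≤ ∑ l ∈ Sirr, (npieces l : ℝ) * wD T y l := by
    rw [LMM, LMs]
    calc ∑ l ∈ LMset T N σ (a : ℕ) (b : ℕ), wD T y l = ∑ l ∈ LMset T N σ (a : ℕ) (b : ℕ), (npieces l : ℝ) * wD T y l := by
          refine sum_congr rfl fun l hl => ?_
          obtain ⟨-, -, -, -, -, -, hren, -⟩ := of_mem_LMset hl
          rw [npieces, hren, Finset.card_empty, zero_add, Nat.cast_one, one_mul]
      _ ≤ ∑ l ∈ Sirr, (npieces l : ℝ) * wD T y l := by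
          refine sum_le_sum_of_subset_of_nonneg (fun l hl => ?_) fun _ _ _ => hψ0 _
          have hl' := hl
          rw [LMset, mem_filter, HBk, mem_filter] at hl
          obtain ⟨⟨hb, h2, hnp, ha, hb'⟩, hsz⟩ := hl
          obtain ⟨-, -, -, -, -, -, hren, -⟩ := of_mem_LMset hl'
          rw [hSirr, mem_filter, hS, LUset, mem_filter, HBab, mem_filter]
          exact ⟨⟨⟨hb, h2, ha, hb'⟩, hsz⟩, hren⟩
  -- (2) the reducible part
  set tgt : Finset (List HV × List HV) := (Finset.univ : Finset (Fin (2 * T))).biUnion fun c =>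
    (Finset.Ico (1 : ℤ) σ).biUnion fun τ => LMset T N τ (a : ℕ) (c : ℕ) ×ˢ LUset T N (σ - τ) (c : ℕ) (b : ℕ) with htgt
  have hmem_tgt : ∀ pq ∈ tgt, ∃ (c : Fin (2 * T)) (τ : ℤ), τ ∈ Finset.Ico (1 : ℤ) σ ∧
      pq.1 ∈ LMset T N τ (a : ℕ) (c : ℕ) ∧ pq.2 ∈ LUset T N (σ - τ) (c : ℕ) (b : ℕ) := by
    intro pq hpq
    rw [htgt, mem_biUnion] at hpq
    obtain ⟨c, -, hpq⟩ := hpq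
    rw [mem_biUnion] at hpq
    obtain ⟨τ, hτ, hpq⟩ := hpq
    rw [mem_product] at hpq
    exact ⟨c, τ, hτ, hpq.1, hpq.2⟩
  have hglue : ∀ pq ∈ tgt, hcat pq.1 pq.2 ∈ Sred ∧ fstP (hcat pq.1 pq.2) = pq.1 ∧
      sndP (hcat pq.1 pq.2) = pq.2.map (shift (pq.1.getLast?.getD hvOrigin).1 0) ∧
      wD T y (hcat pq.1 pq.2) = wD T y pq.1 * wD T y pq.2 ∧ npieces (hcat pq.1 pq.2) = npieces pq.2 + 1 := by
    intro pq hpq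
    obtain ⟨c, τ, hτ, h1, h2⟩ := hmem_tgt pq hpq
    obtain ⟨hmem, hren, hfst, hsnd, hw⟩ := hcat_mem_LUset (y := y) h1 h2 (by rw [Finset.mem_Ico] at hτ; omega)
    refine ⟨?_, hfst, hsnd, hw, ?_⟩
    · rw [hSred, mem_filter, hS]
      rw [show τ + (σ - τ) = σ by ring] at hmem
      exact ⟨hmem, Finset.nonempty_iff_ne_empty.1 hren⟩
    · rw [← npieces_sndP hren, hsnd, npieces_map_shift]
  have hinj : Set.InjOn (fun pq : List HV × List HV => hcat pq.1 pq.2) (tgt : Set (List HV × List HV)) := by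
    rintro ⟨p, q⟩ hpq ⟨p', q'⟩ hpq' heq
    obtain ⟨-, hf, hs, -⟩ := hglue _ hpq
    obtain ⟨-, hf', hs', -⟩ := hglue _ hpq'
    simp only at heq hf hs hf' hs'
    have hp : p = p' := by rw [← hf, ← hf', heq]
    subst hp
    have hq : q.map (shift (p.getLast?.getD hvOrigin).1 0) = q'.map (shift (p.getLast?.getD hvOrigin).1 0) := by
      rw [← hs, ← hs', heq]
    exact Prod.ext rfl ((List.map_injective_iff.2 (shift _ 0).injective) hq)
  -- bookkeeping: the sum over `tgt` of `wD p · (1 + npieces q) · wD q`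
  have htgt_sum : ∑ pq ∈ tgt, wD T y pq.1 * ((npieces pq.2 + 1 : ℝ) * wD T y pq.2) =
      (∑ τ ∈ Finset.Ico (1 : ℤ) σ, LMM T N τ y *
        (LUM T N (σ - τ) y + Matrix.of fun c d : Fin (2 * T) =>
          ∑ l ∈ LUset T N (σ - τ) (c : ℕ) (d : ℕ), (npieces l : ℝ) * wD T y l)) a b := by
    rw [Matrix.sum_apply, htgt, sum_biUnion]
    · have inner : ∀ c : Fin (2 * T), ∑ pq ∈ (Finset.Ico (1 : ℤ) σ).biUnion (fun τ =>
          LMset T N τ (a : ℕ) (c : ℕ) ×ˢ LUset T N (σ - τ) (c : ℕ) (b : ℕ)), wD T y pq.1 * ((npieces pq.2 + 1 : ℝ) * wD T y pq.2) =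
          ∑ τ ∈ Finset.Ico (1 : ℤ) σ, LMs T N τ (a : ℕ) (c : ℕ) y *
            (LUs T N (σ - τ) (c : ℕ) (b : ℕ) y + ∑ l ∈ LUset T N (σ - τ) (c : ℕ) (b : ℕ), (npieces l : ℝ) * wD T y l) := by
        intro c
        rw [sum_biUnion]
        · refine sum_congr rfl fun τ _ => ?_
          rw [sum_product, LMs, LUs, ← sum_add_distrib, sum_mul_sum]
          refine sum_congr rfl fun p _ => sum_congr rfl fun q _ => by ring
        · intro i _ i' _ hne
          rw [Function.onFun, disjoint_left]
          intro pq h1 h2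
          rw [mem_product, LMset, mem_filter] at h1 h2
          exact hne (h1.1.2.symm.trans h2.1.2)
      simp_rw [inner]
      rw [sum_comm]
      refine sum_congr rfl fun τ _ => ?_
      rw [Matrix.mul_apply]
      refine sum_congr rfl fun c _ => ?_
      rw [Matrix.add_apply, Matrix.of_apply]
      rfl
    · intro c _ c' _ hcc'
      rw [Function.onFun, disjoint_left]
      intro pq h1 h2
      rw [mem_biUnion] at h1 h2
      obtain ⟨i, -, h1⟩ := h1
      obtain ⟨i', -, h2⟩ := h2
      rw [mem_product, LMset, mem_filter, HBk, mem_filter] at h1 h2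
      have e1 := h1.1.1.2.2.2.2; have e2 := h2.1.1.2.2.2.2
      exact hcc' (Fin.ext (by have := e1.symm.trans e2; exact_mod_cast this))
  have hred : (∑ τ ∈ Finset.Ico (1 : ℤ) σ, LMM T N τ y *
        (LUM T N (σ - τ) y + Matrix.of fun c d : Fin (2 * T) =>
          ∑ l ∈ LUset T N (σ - τ) (c : ℕ) (d : ℕ), (npieces l : ℝ) * wD T y l)) a b ≤
      ∑ l ∈ Sred, (npieces l : ℝ) * wD T y l := by
    rw [← htgt_sum]
    calc ∑ pq ∈ tgt, wD T y pq.1 * ((npieces pq.2 + 1 : ℝ) * wD T y pq.2)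
        = ∑ pq ∈ tgt, (npieces (hcat pq.1 pq.2) : ℝ) * wD T y (hcat pq.1 pq.2) := by
          refine sum_congr rfl fun pq hpq => ?_
          obtain ⟨-, -, -, hw, hnp⟩ := hglue pq hpq
          rw [hw, hnp]; push_cast; ring
      _ = ∑ l ∈ tgt.image (fun pq => hcat pq.1 pq.2), (npieces l : ℝ) * wD T y l := by rw [sum_image hinj]
      _ ≤ ∑ l ∈ Sred, (npieces l : ℝ) * wD T y l := by
          refine sum_le_sum_of_subset_of_nonneg (fun l hl => ?_) fun _ _ _ => hψ0 _
          rw [mem_image] at hl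
          obtain ⟨pq, hpq, rfl⟩ := hl
          exact (hglue pq hpq).1
  have hsplitS : ∑ l ∈ S, (npieces l : ℝ) * wD T y l =
      ∑ l ∈ Sirr, (npieces l : ℝ) * wD T y l + ∑ l ∈ Sred, (npieces l : ℝ) * wD T y l := by
    rw [hSirr, hSred, ← sum_filter_add_sum_filter_not S (fun l => renIdxs l = ∅)]
  rw [hsplitS]
  exact add_le_add hirr hred

/-- ★★ **Splitting direction of the piece-count split** (`y ≥ 0`): `P_σ(a,b) ≤ M_σ(a,b) + Σ_τ Σ_c M_τ(a,c)(U_{σ−τ} + P_{σ−τ})(c,b)` — a bridge with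
`k + 1 ≥ 2` pieces splits at its first renewal vertex into an irreducible piece and a bridge with `k` pieces (`npieces_sndP`), injectively (as in the tree's
`LUM_le_split`). [cite: DuminilCopinHammond2013, §2.2; lane «pcv-sawmu» a-p2 g23 — own] -/
theorem pieces_le_split (hy : 0 ≤ y) (σ : ℤ) (a b : Fin (2 * T)) :
    (∑ l ∈ LUset T N σ (a : ℕ) (b : ℕ), (npieces l : ℝ) * wD T y l) ≤
      LMM T N σ y a b + (∑ τ ∈ Finset.Ico (1 : ℤ) σ, LMM T N τ y *
        (LUM T N (σ - τ) y + Matrix.of fun c d : Fin (2 * T) =>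
          ∑ l ∈ LUset T N (σ - τ) (c : ℕ) (d : ℕ), (npieces l : ℝ) * wD T y l)) a b := by
  classical
  set S := LUset T N σ (a : ℕ) (b : ℕ) with hS
  set Sirr := S.filter fun l => renIdxs l = ∅ with hSirr
  set Sred := S.filter fun l => renIdxs l ≠ ∅ with hSred
  have hmemS : ∀ l ∈ S, l.IsChain hvGraph.Adj ∧ l.Nodup ∧ l.length ≤ N + 1 ∧ (∃ v, l.head? = some v ∧ v.1 = 0) ∧ InLev T l ∧
      IsHBridge l ∧ 2 ≤ l.length ∧ hdLev l = a ∧ ltLev l = b ∧ hlen l = σ := by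
    intro l hl
    rw [hS, LUset, mem_filter, HBab, mem_filter, mem_hBridgesN_iff] at hl
    obtain ⟨⟨⟨hc, hnd, hlenN, hh, hin, hB⟩, h2, ha, hb⟩, hsz⟩ := hl
    exact ⟨hc, hnd, hlenN, hh, hin, hB, h2, ha, hb, hsz⟩
  -- (1) the irreducible part (`npieces = 1` there)
  have hirr : ∑ l ∈ Sirr, (npieces l : ℝ) * wD T y l ≤ LMM T N σ y a b := by
    rw [LMM, LMs]
    calc ∑ l ∈ Sirr, (npieces l : ℝ) * wD T y l = ∑ l ∈ Sirr, wD T y l := by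
          refine sum_congr rfl fun l hl => ?_
          rw [hSirr, mem_filter] at hl
          rw [npieces, hl.2, Finset.card_empty, zero_add, Nat.cast_one, one_mul]
      _ ≤ _ := by
          refine sum_le_sum_of_subset_of_nonneg (fun l hl => ?_) fun _ _ _ => wD_nonneg T hy _
          rw [hSirr, mem_filter] at hl
          obtain ⟨hl, hren⟩ := hl
          obtain ⟨hc, hnd, hlenN, hh, hin, hB, h2, ha, hb, hsz⟩ := hmemS l hl
          rw [LMset, mem_filter, HBk, mem_filter]
          exact ⟨⟨mem_hBridgesN_iff.2 ⟨hc, hnd, hlenN, hh, hin, hB⟩, h2, by rw [npieces, hren]; rfl, ha, hb⟩, hsz⟩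
  -- (2) the reducible part: the split map into the double union
  set tgt : Finset (List HV × List HV) := (Finset.univ : Finset (Fin (2 * T))).biUnion fun c =>
    (Finset.Ico (1 : ℤ) σ).biUnion fun τ => LMset T N τ (a : ℕ) (c : ℕ) ×ˢ LUset T N (σ - τ) (c : ℕ) (b : ℕ) with htgt
  have himg : ∀ l ∈ Sred, (fstP l, xstd (sndP l)) ∈ tgt := by
    intro l hl
    rw [hSred, mem_filter] at hl
    obtain ⟨hl, hren'⟩ := hl
    have hren : (renIdxs l).Nonempty := Finset.nonempty_iff_ne_empty.2 hren'
    obtain ⟨hc, hnd, hlenN, ⟨v, hv, hv0⟩, hin, hB, h2, ha, hb, hsz⟩ := hmemS l hl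
    have hlens := length_fstP_sndP hren
    obtain ⟨hB1, hB2⟩ := isHBridge_fstP_sndP hB hren
    obtain ⟨e1, e2, e3, e4⟩ := fstP_sndP_ends hren
    obtain ⟨hne1, hne2⟩ := fstP_sndP_ne_nil hren
    have hl0 : l ≠ [] := by rintro rfl; simp at h2
    have hspl := hlen_split hren
    have hf := (fIdx_spec hren).1
    have hlen1 : 2 ≤ (fstP l).length := by rw [fstP, List.length_take]; have := hf.1; have := hf.2.1; omega
    have hlen2 : 2 ≤ (sndP l).length := by rw [sndP, List.length_drop]; have := hf.2.1; omega
    have hτ1 : 1 ≤ hlen (fstP l) := one_le_hlen_of_two_le hB1 hlen1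
    have hτ2 : 1 ≤ hlen (sndP l) := one_le_hlen_of_two_le hB2 hlen2
    set cz : ℤ := lev (l[fIdx l]'(by have := (fIdx_spec hren).1.2.1; omega)) with hcz
    have hcz0 : 0 ≤ cz ∧ cz ≤ 2 * (T : ℤ) - 1 := hin _ (List.getElem_mem _)
    let c : Fin (2 * T) := ⟨cz.toNat, by omega⟩
    have hcc : ((c : ℕ) : ℤ) = cz := by simp [c]; omega
    rw [htgt, mem_biUnion]
    refine ⟨c, mem_univ _, ?_⟩
    rw [mem_biUnion]
    refine ⟨hlen (fstP l), Finset.mem_Ico.2 ⟨hτ1, by omega⟩, mem_product.2 ⟨?_, ?_⟩⟩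
    · show fstP l ∈ LMset T N _ _ _
      rw [LMset, mem_filter, HBk, mem_filter, mem_hBridgesN_iff]
      refine ⟨⟨⟨hc.take _, hnd.sublist (List.take_sublist _ _), by omega, ⟨v, ?_, hv0⟩,
        fun w hw => hin w ((List.take_sublist _ _).subset hw), hB1⟩, hlen1, by rw [npieces, renIdxs_fstP hren]; rfl, ?_, ?_⟩, rfl⟩
      · rw [fstP, List.head?_take, if_neg (by omega), hv]
      · rw [hdLev, fstP, List.head?_take, if_neg (by omega)]; rw [hdLev] at ha; exact ha
      · rw [ltLev, List.getLast?_eq_some_getLast hne1, Option.getD_some, e2, hcc]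
    · show xstd (sndP l) ∈ LUset T N _ _ _
      rw [LUset, mem_filter, HBab, mem_filter, mem_hBridgesN_iff]
      have hv2 : (sndP l).head? = some (l[fIdx l]'(by have := (fIdx_spec hren).1.2.1; omega)) := by
        rw [List.head?_eq_some_head hne2, e3]
      refine ⟨⟨⟨isChain_xstd (hc.drop _), nodup_xstd (hnd.sublist (List.drop_sublist _ _)), by rw [length_xstd]; omega,
        ⟨_, head?_xstd hv2, rfl⟩, inLev_xstd fun w hw => hin w ((List.drop_sublist _ _).subset hw), isHBridge_xstd hB2⟩,
        by rw [length_xstd]; exact hlen2, ?_, ?_⟩, by rw [hlen_xstd]; omega⟩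
      · rw [hdLev, head?_xstd hv2, Option.getD_some, hcc, hcz]; simp [lev, bit]
      · rw [ltLev, xstd, List.getLast?_map, List.getLast?_eq_some_getLast hne2, Option.map_some, Option.getD_some, lev_shift_zero, e4]
        rw [ltLev, List.getLast?_eq_some_getLast hl0, Option.getD_some] at hb; exact hb
  have hinj : Set.InjOn (fun l : List HV => (fstP l, xstd (sndP l))) (Sred : Set (List HV)) := by
    intro l hl l' hl' h
    rw [mem_coe, hSred, mem_filter] at hl hl'
    exact split_injOn (Finset.nonempty_iff_ne_empty.2 hl.2) (Finset.nonempty_iff_ne_empty.2 hl'.2) h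
  have hred : ∑ l ∈ Sred, (npieces l : ℝ) * wD T y l ≤ (∑ τ ∈ Finset.Ico (1 : ℤ) σ, LMM T N τ y *
        (LUM T N (σ - τ) y + Matrix.of fun c d : Fin (2 * T) =>
          ∑ l ∈ LUset T N (σ - τ) (c : ℕ) (d : ℕ), (npieces l : ℝ) * wD T y l)) a b := by
    calc ∑ l ∈ Sred, (npieces l : ℝ) * wD T y l
        = ∑ l ∈ Sred, wD T y (fstP l) * ((npieces (xstd (sndP l)) + 1 : ℝ) * wD T y (xstd (sndP l))) := by
          refine sum_congr rfl fun l hl => ?_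
          rw [hSred, mem_filter] at hl
          have hren := Finset.nonempty_iff_ne_empty.2 hl.2
          rw [wD_eq_mul_fstP_sndP T y hren, npieces_xstd, ← npieces_sndP hren]
          have : wD T y (xstd (sndP l)) = wD T y (sndP l) := by
            rw [wD, wD, length_xstd, xstd, ← List.map_tail, topCnt_map_shift]
          rw [this]; push_cast; ring
      _ = ∑ pq ∈ Sred.image fun l => (fstP l, xstd (sndP l)), wD T y pq.1 * ((npieces pq.2 + 1 : ℝ) * wD T y pq.2) := by
          rw [sum_image hinj]
      _ ≤ ∑ pq ∈ tgt, wD T y pq.1 * ((npieces pq.2 + 1 : ℝ) * wD T y pq.2) := by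
          refine sum_le_sum_of_subset_of_nonneg (fun pq hpq => ?_)
            fun pq _ _ => mul_nonneg (wD_nonneg T hy _) (mul_nonneg (by positivity) (wD_nonneg T hy _))
          rw [mem_image] at hpq
          obtain ⟨l, hl, rfl⟩ := hpq
          exact himg l hl
      _ = _ := by
          rw [Matrix.sum_apply, htgt, sum_biUnion]
          · have inner : ∀ c : Fin (2 * T), ∑ pq ∈ (Finset.Ico (1 : ℤ) σ).biUnion (fun τ =>
                LMset T N τ (a : ℕ) (c : ℕ) ×ˢ LUset T N (σ - τ) (c : ℕ) (b : ℕ)), wD T y pq.1 * ((npieces pq.2 + 1 : ℝ) * wD T y pq.2) =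
                ∑ τ ∈ Finset.Ico (1 : ℤ) σ, LMs T N τ (a : ℕ) (c : ℕ) y *
                  (LUs T N (σ - τ) (c : ℕ) (b : ℕ) y + ∑ l ∈ LUset T N (σ - τ) (c : ℕ) (b : ℕ), (npieces l : ℝ) * wD T y l) := by
              intro c
              rw [sum_biUnion]
              · refine sum_congr rfl fun τ _ => ?_
                rw [sum_product, LMs, LUs, ← sum_add_distrib, sum_mul_sum]
                refine sum_congr rfl fun p _ => sum_congr rfl fun q _ => by ring
              · intro i _ i' _ hne
                rw [Function.onFun, disjoint_left]
                intro pq h1 h2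
                rw [mem_product, LMset, mem_filter] at h1 h2
                exact hne (h1.1.2.symm.trans h2.1.2)
            simp_rw [inner]
            rw [sum_comm]
            refine sum_congr rfl fun τ _ => ?_
            rw [Matrix.mul_apply]
            refine sum_congr rfl fun c _ => ?_
            rw [Matrix.add_apply, Matrix.of_apply]
            rfl
          · intro c _ c' _ hcc'
            rw [Function.onFun, disjoint_left]
            intro pq h1 h2
            rw [mem_biUnion] at h1 h2
            obtain ⟨i, -, h1⟩ := h1
            obtain ⟨i', -, h2⟩ := h2
            rw [mem_product, LMset, mem_filter, HBk, mem_filter] at h1 h2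
            have e1 := h1.1.1.2.2.2.2; have e2 := h2.1.1.2.2.2.2
            exact hcc' (Fin.ext (by have := e1.symm.trans e2; exact_mod_cast this))
  have hsplitS : ∑ l ∈ S, (npieces l : ℝ) * wD T y l =
      ∑ l ∈ Sirr, (npieces l : ℝ) * wD T y l + ∑ l ∈ Sred, (npieces l : ℝ) * wD T y l := by
    rw [hSirr, hSred, ← sum_filter_add_sum_filter_not S (fun l => renIdxs l = ∅)]
  rw [hsplitS]
  exact add_le_add hirr hred

/-- ★★★ **THE PIECE-COUNT SPLIT IS EXACT** (`σ ≤ N`, `y ≥ 0`): `P_σ(a,b) = M_σ(a,b) + Σ_{τ∈[1,σ)} Σ_c M_τ(a,c)·(U_{σ−τ}(c,b) + P_{σ−τ}(c,b))`,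
`P_σ(a,b) = Σ_{bridges a→b with σ steps} (number of irreducible pieces) · x_c^σ y^{#top}`: the number of pieces is one more than the number of pieces
of the remainder after the first renewal vertex. [cite: DuminilCopinHammond2013, §2.2; Feller1968, XIII.3; lane «pcv-sawmu» a-p2 g23 — own] -/
theorem pieces_eq_split (hy : 0 ≤ y) (hσN : σ ≤ N) (a b : Fin (2 * T)) :
    (∑ l ∈ LUset T N σ (a : ℕ) (b : ℕ), (npieces l : ℝ) * wD T y l) =
      LMM T N σ y a b + (∑ τ ∈ Finset.Ico (1 : ℤ) σ, LMM T N τ y *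
        (LUM T N (σ - τ) y + Matrix.of fun c d : Fin (2 * T) =>
          ∑ l ∈ LUset T N (σ - τ) (c : ℕ) (d : ℕ), (npieces l : ℝ) * wD T y l)) a b :=
  le_antisymm (pieces_le_split hy σ a b) (split_le_pieces hy hσN a b)

end Split

/-! ### §2 The hat (parity-class) form of the piece-count split -/

section Hat

/-- The piece-count slice vanishes for `σ ≤ 0` (a bridge has at least one step; plumbing). [cite: DuminilCopinHammond2013, §2.2; lane plumbing a-p2 g23] -/
theorem pieces_eq_zero_of_le (hσ : σ ≤ 0) (y : ℝ) (a b : ℤ) :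
    (∑ l ∈ LUset T N σ a b, (npieces l : ℝ) * wD T y l) = 0 := by
  refine sum_eq_zero fun l hl => ?_
  exfalso
  obtain ⟨-, -, -, -, -, -, h2, -, -, hsz⟩ := of_mem_LUset hl
  unfold hlen at hsz; omega

/-- Parity: the piece-count slice `P_σ(a,b)` vanishes unless `σ ≡ a + b (mod 2)` (plumbing). [cite: DuminilCopinSmirnov2012, §3; lane plumbing a-p2 g23] -/
theorem pieces_eq_zero_of_not_even (y : ℝ) (a b : Fin (2 * T)) (h : ¬ Even (σ + (a : ℕ) + (b : ℕ))) :
    (∑ l ∈ LUset T N σ (a : ℕ) (b : ℕ), (npieces l : ℝ) * wD T y l) = 0 := by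
  refine sum_eq_zero fun q hq => ?_
  exfalso
  obtain ⟨hc, -, -, -, -, -, h2, ha, hb, hsz⟩ := of_mem_LUset hq
  have hne : q ≠ [] := by rintro rfl; simp at h2
  obtain ⟨k, hk⟩ := chain_parity_even hc hne
  rw [ha, hb, hsz] at hk
  exact h ⟨((b : ℕ) : ℤ) - k, by omega⟩

/-- Truncation independence of the piece-count slice (plumbing). [cite: DuminilCopinHammond2013, §2.2; lane plumbing a-p2 g23] -/
theorem pieces_trunc_eq {N N' : ℕ} (hσ : σ ≤ N) (hσ' : σ ≤ N') (y : ℝ) (a b : ℤ) :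
    (∑ l ∈ LUset T N σ a b, (npieces l : ℝ) * wD T y l) = ∑ l ∈ LUset T N' σ a b, (npieces l : ℝ) * wD T y l := by
  rw [LUset_eq_of_le hσ hσ' a b]

/-- ★★ **The piece-count split along the parity classes**: with `P̂(k)_{ab} := P_{2k+χ_a−χ_b}(a,b)` (truncation `2k+1`),
`P̂(k) = M̂(k) + Σ_{i+j=k} M̂(i)·(D̂(j) + P̂(j))` for every `y ≥ 0` — the regrouping of `pieces_eq_split` exactly as the tree's `hat_ren` regroups `LUM_eq_split`.
[cite: Feller1968, XIII.3 (periodic renewal sequences); DuminilCopinHammond2013, §2.2; lane «pcv-sawmu» a-p2 g23 — own] -/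
theorem hat_pieces_ren (hy : 0 ≤ y) (k : ℕ) :
    (Matrix.of fun a b : Fin (2 * T) => ∑ l ∈ LUset T (2 * k + 1) (hatLen k a b) (a : ℕ) (b : ℕ), (npieces l : ℝ) * wD T y l) =
      hatM T y k + ∑ p ∈ antidiagonal k, hatM T y p.1 *
        (hatD T y p.2 + Matrix.of fun a b : Fin (2 * T) =>
          ∑ l ∈ LUset T (2 * p.2 + 1) (hatLen p.2 a b) (a : ℕ) (b : ℕ), (npieces l : ℝ) * wD T y l) := by
  ext a b
  have hχa := (lchi_facts a).1; have hχb := (lchi_facts b).1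
  set σ : ℤ := hatLen k a b with hσdef
  have hσN : σ ≤ ((2 * k + 1 : ℕ) : ℤ) := by rw [hσdef]; unfold hatLen; push_cast; omega
  rw [Matrix.add_apply, Matrix.of_apply, pieces_eq_split hy hσN a b, show LMM T (2 * k + 1) σ y a b = hatM T y k a b from rfl]
  congr 1
  rw [Matrix.sum_apply, Matrix.sum_apply]
  simp only [Matrix.mul_apply]
  rw [sum_comm, sum_comm (s := antidiagonal k)]
  refine sum_congr rfl fun c _ => ?_
  have hχc := (lchi_facts c).1
  -- for the fixed middle level `c`: both sides are sums of `f τ := M_τ(a,c) (U + P)_{σ−τ}(c,b)` (truncation `2k+1`)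
  set f : ℤ → ℝ := fun τ => LMM T (2 * k + 1) τ y a c * (LUM T (2 * k + 1) (σ - τ) y c b +
    ∑ l ∈ LUset T (2 * k + 1) (σ - τ) (c : ℕ) (b : ℕ), (npieces l : ℝ) * wD T y l) with hfdef
  set δ₁ : ℤ := lchi a - lchi c with hδ₁
  -- right side, rewritten with truncation `2k+1` and as an image sum
  have hR : ∑ p ∈ antidiagonal k, hatM T y p.1 a c * (hatD T y p.2 + Matrix.of fun a b : Fin (2 * T) =>
      ∑ l ∈ LUset T (2 * p.2 + 1) (hatLen p.2 a b) (a : ℕ) (b : ℕ), (npieces l : ℝ) * wD T y l) c b =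
      ∑ i ∈ range (k + 1), f (2 * (i : ℤ) + δ₁) := by
    rw [Nat.sum_antidiagonal_eq_sum_range_succ_mk]
    refine sum_congr rfl fun i hi => ?_
    rw [mem_range] at hi
    have hi1 : hatLen i a c ≤ ((2 * k + 1 : ℕ) : ℤ) := by unfold hatLen; push_cast; omega
    have hi2 : hatLen (k - i) c b ≤ ((2 * k + 1 : ℕ) : ℤ) := by unfold hatLen; push_cast; omega
    have hi2' : hatLen (k - i) c b ≤ ((2 * (k - i) + 1 : ℕ) : ℤ) := by unfold hatLen; push_cast; omega
    rw [Matrix.add_apply, Matrix.of_apply, ← (hat_trunc i a c hi1).1, ← (hat_trunc (k - i) c b hi2).2,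
      pieces_trunc_eq hi2' hi2, hfdef]
    simp only
    have e1 : hatLen i a c = 2 * (i : ℤ) + δ₁ := by rw [hδ₁]; unfold hatLen; ring
    have e2 : hatLen (k - i) c b = σ - (2 * (i : ℤ) + δ₁) := by
      rw [hσdef, hδ₁]; unfold hatLen; push_cast [Nat.cast_sub (show i ≤ k by omega)]; ring
    rw [e1, e2]
  rw [hR]
  have hinj : Set.InjOn (fun i : ℕ => 2 * (i : ℤ) + δ₁) (range (k + 1) : Finset ℕ) := fun i _ j _ h => by
    simpa using h
  rw [← sum_image hinj]
  set S : Finset ℤ := (range (k + 1)).image (fun i : ℕ => 2 * (i : ℤ) + δ₁) with hSdef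
  change ∑ τ ∈ Finset.Ico (1 : ℤ) σ, f τ = ∑ τ ∈ S, f τ
  have hvan1 : ∀ τ ∈ S, τ ∉ Finset.Ico (1 : ℤ) σ → f τ = 0 := by
    intro τ hτ hτI
    rw [hSdef, mem_image] at hτ
    obtain ⟨i, hi, rfl⟩ := hτ
    rw [mem_range] at hi
    rw [Finset.mem_Ico, not_and_or, not_le, not_lt] at hτI
    rw [hfdef]; simp only
    rcases hτI with h0 | h0
    · rw [LMM_eq_zero_of_le (by omega), zero_mul]
    · rw [LUM_eq_zero_of_le (by omega), pieces_eq_zero_of_le (by omega), add_zero, mul_zero]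
  have hvan2 : ∀ τ ∈ Finset.Ico (1 : ℤ) σ, τ ∉ S → f τ = 0 := by
    intro τ hτI hτ
    rw [Finset.mem_Ico] at hτI
    rw [hfdef]; simp only
    have hpar : ¬ Even (τ + (a : ℕ) + (c : ℕ)) := by
      rintro ⟨m, hm⟩
      apply hτ
      obtain ⟨ja, hja⟩ := (lchi_facts a).2
      obtain ⟨jc, hjc⟩ := (lchi_facts c).2
      have hσ' : σ = 2 * (k : ℤ) + lchi a - lchi b := by rw [hσdef]; unfold hatLen; ring
      rw [hSdef, mem_image]
      exact ⟨((τ - δ₁) / 2).toNat, mem_range.2 (by omega), (by omega : 2 * ((((τ - δ₁) / 2).toNat : ℕ) : ℤ) + δ₁ = τ)⟩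
    rw [(LUM_LMM_eq_zero_of_not_even y a c hpar).2, zero_mul]
  have e1 : ∑ τ ∈ Finset.Ico (1 : ℤ) σ ∩ S, f τ = ∑ τ ∈ Finset.Ico (1 : ℤ) σ, f τ :=
    sum_subset inter_subset_left fun τ hτI hτn => hvan2 τ hτI fun hτS => hτn (mem_inter.2 ⟨hτI, hτS⟩)
  have e2 : ∑ τ ∈ Finset.Ico (1 : ℤ) σ ∩ S, f τ = ∑ τ ∈ S, f τ :=
    sum_subset inter_subset_right fun τ hτS hτn => hvan1 τ hτS fun hτI => hτn (mem_inter.2 ⟨hτI, hτS⟩)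
  rw [← e1, e2]

end Hat

/-! ### §3 The density of renewal points (irreducible pieces) of long critical bridges -/

section Density

variable {u ℓ : Fin (2 * T) → ℝ}

/-- `0 ≤ P̂(k)_{ab} ≤ (2k+3)·D̂(k)_{ab}` at any `y ≥ 0`: a bridge with `n` steps has at most `n + 2` pieces (plumbing).
[cite: DuminilCopinHammond2013, §2.2; lane plumbing a-p2 g23] -/
theorem hat_pieces_facts (hy : 0 ≤ y) (k : ℕ) (a b : Fin (2 * T)) :
    0 ≤ ∑ l ∈ LUset T (2 * k + 1) (hatLen k a b) (a : ℕ) (b : ℕ), (npieces l : ℝ) * wD T y l ∧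
      ∑ l ∈ LUset T (2 * k + 1) (hatLen k a b) (a : ℕ) (b : ℕ), (npieces l : ℝ) * wD T y l ≤ (2 * k + 3) * hatD T y k a b := by
  have h0 : ∀ l : List HV, 0 ≤ (npieces l : ℝ) * wD T y l := fun l => mul_nonneg (Nat.cast_nonneg _) (wD_nonneg T hy _)
  refine ⟨sum_nonneg fun l _ => h0 l, ?_⟩
  rw [hatD, LUM, LUs, mul_sum]
  refine sum_le_sum fun l hl => mul_le_mul_of_nonneg_right ?_ (wD_nonneg T hy _)
  obtain ⟨-, -, hlen, -⟩ := of_mem_LUset hl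
  have h1 : npieces l ≤ l.length + 1 := by
    rw [npieces, renIdxs]
    have := (range l.length).card_filter_le (fun i => IsRenewalIdx l i)
    rw [Finset.card_range] at this
    omega
  have h2 : (npieces l : ℝ) ≤ (l.length : ℝ) + 1 := by exact_mod_cast h1
  have h3 : (l.length : ℝ) ≤ 2 * k + 2 := by exact_mod_cast (show l.length ≤ 2 * k + 2 by omega)
  linarith

/-- ★★★★ **THE DENSITY OF RENEWAL POINTS OF LONG CRITICAL BRIDGES** (`T ≥ 2`).  For all levels `a, b`, along the parity class
`n_k = 2k + χ_a − χ_b`, with `P̂(k)_{ab} = Σ_{bridges a→b, n_k steps} npieces · x_c^{n_k} y_T^{#top}` (`npieces` = number of irreducible pieces = number of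
renewal vertices + 1):
`P̂(k)_{ab} / ((k+1) · D̂(k)_{ab}) ⟶ 2⟨ℓ, u⟩/⟨ℓ, M̄_len u⟩`
(`u`, `ℓ` any positive fixed vectors of the critical kernel `Iinf T y_T`; the quotient is scale-free) — by the elementary renewal theorem of
`Process/MatrixRenewalReward` (reward `R = Î`, `Σ_c L_{oc}M̂_{cd}… = L_{od}`) for the reward pair `(M̂, P̂)` of §2 over the critical hat pair (`hatPair_critical`,
explicit residue `ρ = 1/⟨ℓ, M̄_len u⟩` of «AMPLITUDE-RATIO»). [cite: Feller1968, XIII.3 (elementary renewal theorem), XIII.11; DuminilCopinHammond2013, §2.2 (renewal points of bridges); lane «pcv-sawmu» a-p2 g23 — own result] -/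
theorem tendsto_hat_pieces_div (hT : 2 ≤ T) (hu0 : ∀ a, 0 < u a) (hℓ0 : ∀ b, 0 < ℓ b)
    (hu : Iinf T (stripYT T) *ᵥ u = u) (hℓ : ℓ ᵥ* Iinf T (stripYT T) = ℓ) (a b : Fin (2 * T)) :
    Tendsto (fun k : ℕ => (∑ l ∈ LUset T (2 * k + 1) (hatLen k a b) (a : ℕ) (b : ℕ), (npieces l : ℝ) * wD T (stripYT T) l) /
        ((k + 1) * hatD T (stripYT T) k a b)) atTop
      (𝓝 (2 * (ℓ ⬝ᵥ u) / (ℓ ⬝ᵥ ((Matrix.of fun a b : Fin (2 * T) => ∑' n : ℕ, (n : ℝ) * LMM T n (n : ℤ) (stripYT T) a b) *ᵥ u)))) := by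
  have hT1 : 1 ≤ T := by omega
  have hyT : 0 < stripYT T := stripYT_pos hT1
  obtain ⟨hl, hL⟩ := tendsto_stripLenD_residue_explicit hT hu0 hℓ0 hu hℓ
  set dl := ℓ ⬝ᵥ ((Matrix.of fun a b : Fin (2 * T) => ∑' n : ℕ, (n : ℝ) * LMM T n (n : ℤ) (stripYT T) a b) *ᵥ u) with hdl
  have hres : ∀ a b, Tendsto (fun s : ℝ => (1 - s) * stripLenD T s a b) (𝓝[<] 1) (𝓝 (1 / dl * (u a * ℓ b))) := fun a b => by
    have := hL a b; rwa [show u a * ℓ b / dl = 1 / dl * (u a * ℓ b) by ring] at this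
  have hcrit := hatPair_critical hT hu0 hℓ0 (one_div_pos.2 hl) hres
  set K := hatPair T hyT.le with hK
  let W : RenewalKernelPair.RewardPair K :=
    { R := hatM T (stripYT T)
      S := fun k => Matrix.of fun a b : Fin (2 * T) =>
        ∑ l ∈ LUset T (2 * k + 1) (hatLen k a b) (a : ℕ) (b : ℕ), (npieces l : ℝ) * wD T (stripYT T) l
      R_nonneg := fun k a b => (LMM_LUM_nonneg hyT.le _ a b).1
      S_nonneg := fun k a b => (hat_pieces_facts hyT.le k a b).1
      ren := fun k => by
        rw [hat_pieces_ren hyT.le k]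
        congr 1
        refine sum_congr rfl fun p _ => ?_
        rw [Matrix.mul_add]
        rfl
      summable_R := fun a b => hcrit.summable_M a b
      summable_S := fun a b s hs0 hs1 => by
        obtain ⟨B, hB⟩ := (K.tendsto_coeff hcrit a b).bddAbove_range
        have hB' : ∀ k, hatD T (stripYT T) k a b ≤ B := fun k => hB ⟨k, rfl⟩
        have hB0 : 0 ≤ B := (LMM_LUM_nonneg hyT.le _ a b).2.trans (hB' 0)
        have hg : Summable fun k : ℕ => (2 * k + 3) * B * s ^ k := by
          have h1 : Summable fun k : ℕ => (k : ℝ) * s ^ k := by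
            have := summable_pow_mul_geometric_of_norm_lt_one 1 (show ‖s‖ < 1 by rw [Real.norm_eq_abs, abs_of_nonneg hs0]; exact hs1)
            simpa using this
          have h2 : Summable fun k : ℕ => s ^ k := summable_geometric_of_lt_one hs0 hs1
          have : (fun k : ℕ => (2 * k + 3) * B * s ^ k) = fun k : ℕ => 2 * B * ((k : ℝ) * s ^ k) + 3 * B * s ^ k := by
            funext k; ring
          rw [this]
          exact (h1.mul_left _).add (h2.mul_left _)
        refine hg.of_nonneg_of_le (fun k => mul_nonneg (hat_pieces_facts hyT.le k a b).1 (pow_nonneg hs0 _)) fun k => ?_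
        simp only [Matrix.of_apply]
        refine mul_le_mul_of_nonneg_right ?_ (pow_nonneg hs0 _)
        exact (hat_pieces_facts hyT.le k a b).2.trans (mul_le_mul_of_nonneg_left (hB' k) (by positivity)) }
  have hmain := W.tendsto_S_div_D hcrit a a b
  have hval : (∑ d, (∑ c, 2 * (1 / dl * (u a * ℓ c)) * ∑' j : ℕ, W.R j c d) * (2 * (1 / dl * (u d * ℓ a)))) /
      (2 * (1 / dl * (u a * ℓ a))) = 2 * (ℓ ⬝ᵥ u) / dl := by
    have hM : ∀ d, ∑ c, 2 * (1 / dl * (u a * ℓ c)) * ∑' j : ℕ, W.R j c d = 2 * (1 / dl * (u a * ℓ d)) := fun d =>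
      hcrit.L_mul_tsum_M a d
    simp_rw [hM]
    have hne : 2 * (1 / dl * (u a * ℓ a)) ≠ 0 := by have := hu0 a; have := hℓ0 a; positivity
    rw [div_eq_iff hne, dotProduct]
    have hdl0 : dl ≠ 0 := hl.ne'
    have hterm : ∀ d, 2 * (1 / dl * (u a * ℓ d)) * (2 * (1 / dl * (u d * ℓ a))) =
        (ℓ d * u d) * ((2 / dl) * (2 * (1 / dl * (u a * ℓ a)))) := fun d => by ring
    simp_rw [hterm]
    rw [← sum_mul]
    field_simp
  rw [hval] at hmain
  exact hmain

/-- `(k+1)/(2k + χ_a − χ_b) → 1/2` (plumbing). [folklore] -/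
private theorem tendsto_succ_div_hatLen' (a b : Fin (2 * T)) :
    Tendsto (fun k : ℕ => ((k : ℝ) + 1) / (hatLen k a b : ℝ)) atTop (𝓝 (1 / 2)) := by
  set e : ℤ := lchi a - lchi b with he
  have hL : ∀ k : ℕ, (hatLen k a b : ℝ) = 2 * (k : ℝ) + (e : ℝ) := fun k => by unfold hatLen; push_cast; rw [he]; push_cast; ring
  have hden : Tendsto (fun k : ℕ => 2 * (k : ℝ) + (e : ℝ)) atTop atTop :=
    (tendsto_natCast_atTop_atTop.const_mul_atTop two_pos).atTop_add tendsto_const_nhds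
  have hsmall : Tendsto (fun k : ℕ => (1 - (e : ℝ) / 2) / (2 * (k : ℝ) + (e : ℝ))) atTop (𝓝 0) :=
    tendsto_const_nhds.div_atTop hden
  have hlim : Tendsto (fun k : ℕ => 1 / 2 + (1 - (e : ℝ) / 2) / (2 * (k : ℝ) + (e : ℝ))) atTop (𝓝 (1 / 2 + 0)) :=
    tendsto_const_nhds.add hsmall
  rw [add_zero] at hlim
  refine hlim.congr' ?_
  filter_upwards [hden.eventually_gt_atTop 0] with k hk
  rw [hL k]
  field_simp
  ring

/-- ★★★★ **RENEWAL POINTS PER STEP** (`T ≥ 2`): for all levels `a, b`, along `n_k = 2k + χ_a − χ_b`,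
`P̂(k)_{ab} / (n_k · D̂(k)_{ab}) ⟶ ν_T := ⟨ℓ, u⟩ / ⟨ℓ, M̄_len u⟩`
— the mean number of irreducible pieces (equivalently, of renewal vertices) PER STEP of a critical strip bridge with exactly `n` steps converges to
`ν_T = 1/(mean length of an irreducible piece under the invariant weighting ℓ_c M(n)_{cd} u_d)`, the same for every pair of levels.
[cite: Feller1968, XIII.3 (elementary renewal theorem); DuminilCopinHammond2013, §2.2; lane «pcv-sawmu» a-p2 g23 — own result] -/
theorem tendsto_pieces_per_step (hT : 2 ≤ T) (hu0 : ∀ a, 0 < u a) (hℓ0 : ∀ b, 0 < ℓ b)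
    (hu : Iinf T (stripYT T) *ᵥ u = u) (hℓ : ℓ ᵥ* Iinf T (stripYT T) = ℓ) (a b : Fin (2 * T)) :
    Tendsto (fun k : ℕ => (∑ l ∈ LUset T (2 * k + 1) (hatLen k a b) (a : ℕ) (b : ℕ), (npieces l : ℝ) * wD T (stripYT T) l) /
        ((hatLen k a b : ℝ) * hatD T (stripYT T) k a b)) atTop
      (𝓝 ((ℓ ⬝ᵥ u) / (ℓ ⬝ᵥ ((Matrix.of fun a b : Fin (2 * T) => ∑' n : ℕ, (n : ℝ) * LMM T n (n : ℤ) (stripYT T) a b) *ᵥ u)))) := by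
  have h1 := tendsto_hat_pieces_div hT hu0 hℓ0 hu hℓ a b
  have h2 := tendsto_succ_div_hatLen' (T := T) a b
  have h := h1.mul h2
  rw [show 2 * (ℓ ⬝ᵥ u) / (ℓ ⬝ᵥ ((Matrix.of fun a b : Fin (2 * T) => ∑' n : ℕ, (n : ℝ) * LMM T n (n : ℤ) (stripYT T) a b) *ᵥ u)) * (1 / 2) =
      (ℓ ⬝ᵥ u) / (ℓ ⬝ᵥ ((Matrix.of fun a b : Fin (2 * T) => ∑' n : ℕ, (n : ℝ) * LMM T n (n : ℤ) (stripYT T) a b) *ᵥ u)) by ring] at h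
  refine h.congr' ?_
  have hden : Tendsto (fun k : ℕ => (hatLen k a b : ℝ)) atTop atTop := by
    have hL : ∀ k : ℕ, (hatLen k a b : ℝ) = 2 * (k : ℝ) + ((lchi a - lchi b : ℤ) : ℝ) := fun k => by
      unfold hatLen; push_cast; ring
    simp_rw [hL]
    exact (tendsto_natCast_atTop_atTop.const_mul_atTop two_pos).atTop_add tendsto_const_nhds
  filter_upwards [hden.eventually_gt_atTop 0] with k hk
  have hk1 : (k : ℝ) + 1 ≠ 0 := by positivity
  by_cases hD : hatD T (stripYT T) k a b = 0
  · simp [hD]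
  · field_simp

end Density

end HV

end Literature.Probability.RandomPlanarGeometry.SAW
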